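import Summits.ValiantsHypothesis.ValiantsHypothesis.Theorems.GrenetZeonDualUnipotentThreeHalvesSlowCoreGlue

/-!
# `GrenetZeon.DualUnipotentThreeHalves` (stmt-ValiantsHypothesis-24318), line `slow_core` — IRREDUCIBILITY IS FREE in (c)

val-idea-27 g8 (lens (b), weights), 2026-08-29.  A by-name reading of the ✓ MASS-CUT GLUE (`SlowCore.slow_of_longMassSlowLawInv`,
✓ p680768) with the regime inequality removed:

* `relCert_of_levelCut` — **SUB-ADDITIVITY OF THE PRICE OVER A LEVEL CUT.**  If a constant conjugate `N' = G·N·G'` of an affine pencil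
  `N : AffMat n m` is `LevelCut` for some level function, and every BIG level class (size `≥ √n + 1`) has a class-pencil certificate of
  price `≤ c·√n·size`, then `RelCert n m N (c·√n·m + 4·m·√n + 4·m + n)`.  (Small classes are merged and frozen, levels stacked by
  ✓ `shortMassLedger0_holds`; literally the large-`m` branch of the glue, conclusion `RelCert` instead of `Slow`.)
* `relCert_of_inv_at` — at a fixed `n ≥ 1`: (c) at constant `c` for the `IrreducibleInv` nilpotent affine pencils of every size
  ⇒ price `≤ (c+10)·√n·m` for EVERY nilpotent affine `m × m` pencil (composition series ✓ `exists_block_conj`).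
* `all_of_inv`, `inv_iff_all` — **`LongMassSlowLawInv ↔ LongMassSlowLawAll`**: the ONE open research statement (c) of the line does
  not depend on its irreducibility hypothesis (constants `c ↦ c + 10`, `n₀ ↦ max n₀ 1`).

USE (memo `MEMO-idea27-g8-weight-lens.md` §1).  (i) ENEMY HUNT: a (c)-violator family may be ANY affine nilpotent pencil family whose
price is not `O(√n·b)` — the clauses «`IrreducibleInv`» (V34 §2) and «a limit of irreducible nil pencils» (V35 §3 (β)) are vacuous; conversely
an expensive pencil has an expensive IRREDUCIBLE CONSTITUENT (contrapositive of `relCert_of_levelCut`), so violators may be sought among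
irreducibles — in the graded corner (β) with simple torus weights: among STRONGLY CONNECTED graded pencils (memo §1, paper).
(ii) ROWS: any class of pencils is priced through its big irreducible constituents (`relCert_of_levelCut` with the user's own cut — e.g. the
SCC condensation of a graded pencil).
Honest framing.  Support lemmas / a reformulation of the stub, NOT progress on (c); (c) `LongMassSlowLawInv`, S3, 24318, 8062, VP ≠ VNP are
OPEN / NOT proved.  No sorry, no new axioms, no definitions beyond the Prop `LongMassSlowLawAll`.
-/

-- single-conjunct layout: Sub = Summit, duplicated namespace component intended (the name is mandated)
set_option linter.dupNamespace false
set_option autoImplicit false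

noncomputable section

namespace Summit.ValiantsHypothesis.ValiantsHypothesis.Cruxes.DualUnipotentThreeHalves.IrreducibilityIsFree

open MvPolynomial Matrix
open scoped BigOperators
open Summit.ValiantsHypothesis.ValiantsHypothesis.Cruxes.TwoDimCoefficients.DimTwoCases (AffMat IsAffine)
open Summit.ValiantsHypothesis.ValiantsHypothesis.Theorems.GrenetZeon.RadicalSplit (lineSubst pencilAlg)
open Summit.ValiantsHypothesis.ValiantsHypothesis.Theorems.GrenetZeon.SlowCore
open Summit.ValiantsHypothesis.ValiantsHypothesis.Theorems.GrenetZeon.HeavyTopCompositionBound (exists_block_conj)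

/-- **(c) for ALL affine nilpotent pencils** (no irreducibility hypothesis): every nilpotent affine `b × b` pencil over the `n²`
coordinates has a certificate of price `≤ c·√n·b`.  RESEARCH statement; by `inv_iff_all` EQUIVALENT to the stub's `LongMassSlowLawInv`. -/
def LongMassSlowLawAll : Prop :=
  ∃ c n₀ : ℕ, ∀ n ≥ n₀, ∀ b : ℕ, ∀ B : AffMat n b, IsAffine B → B ^ b = 0 → RelCert n b B (c * (Nat.sqrt n * b))

/-- The trivial direction. -/
theorem inv_of_all (h : LongMassSlowLawAll) : LongMassSlowLawInv := by
  obtain ⟨c, n₀, h⟩ := h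
  exact ⟨c, n₀, fun n hn b B hB hnil _ => h n hn b B hB hnil⟩

section SubAdditivity

variable {n m : ℕ}

/-- FREEZE EVERYTHING (V34 (U1) in its crudest form): an affine `m × m` pencil has a certificate of price `≤ m²` (window `0`). -/
theorem relCert_freeze_all (N : AffMat n m) (hN : IsAffine N) : RelCert n m N (m * m) := by
  classical
  set K0 : Submodule ℂ (Fin n × Fin n → ℂ) := freezeSpace N (Finset.univ : Finset (Fin m × Fin m)) with hK0
  have hfr : Freezes N (fun i j => (fun _ : Fin m => 0) i = 0 ∧ (fun _ : Fin m => 0) j = 0) K0 :=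
    fun i j _ v hv => linEntry_eq_zero_of_mem_freezeSpace N _ (Finset.mem_univ (i, j)) hv
  have hcut0 : LevelCut N (fun _ => 0) := fun i j h => absurd h (lt_irrefl _)
  have hL0 := ledger_class_of_frozen N hN hcut0 0 hfr
  have htop0 : Ledger n m N (fun _ => True) K0 0 := ledger_mono hL0 (fun _ _ => rfl) le_rfl le_rfl
  refine ⟨K0, 0, htop0, ?_⟩
  have hcod := codim_freezeSpace_le N (Finset.univ : Finset (Fin m × Fin m))
  rw [Finset.card_univ, Fintype.card_prod, Fintype.card_fin, ← hK0] at hcod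
  omega

/-- ★ **SUB-ADDITIVITY OF THE PRICE OVER A LEVEL CUT.**  Let `N' = G·N·G'` (`G'G = GG' = 1`, constants) be `LevelCut` for `lvl : Fin m → ℕ`
(levels `< L`), `N` affine, `1 ≤ n`.  If every level class of size `≥ √n + 1` has, for SOME re-indexing `e`, a class-pencil certificate of price
`≤ c·√n·size`, then the whole pencil has price `≤ c·√n·m + 4·m·√n + 4·m + n`.  (The large-`m` branch of ✓ `slow_of_longMassSlowLawInv` verbatim:
coarsen at `T = √n + 1`, freeze the merged small runs — codim `≤ 2mT` —, transport the big classes' ledgers, stack by ✓ `shortMassLedger0_holds`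
— window `+ (#classes − 1) ≤ 2(m/T) + 1` —, return to `N` by ✓ `ledger_top_of_conj`.)  Small classes need NO hypothesis (they are frozen). -/
theorem relCert_of_levelCut (hn : 1 ≤ n) (c : ℕ) (N N' : AffMat n m) (hN : IsAffine N) (G G' : Matrix (Fin m) (Fin m) ℂ)
    (hGG : G' * G = 1) (hN'def : N' = G.map C * N * G'.map C) {L : ℕ} (lvl : Fin m → ℕ) (hlvl : ∀ i, lvl i < L)
    (hcut : LevelCut N' lvl)
    (hbig : ∀ t : ℕ, t < L → Nat.sqrt n + 1 ≤ lvlSize lvl t →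
      ∃ (e : {i : Fin m // lvl i = t} ≃ Fin (lvlSize lvl t)),
        RelCert n (lvlSize lvl t) (classPencil N' e) (c * (Nat.sqrt n * lvlSize lvl t))) :
    RelCert n m N (c * (Nat.sqrt n * m) + 4 * (m * Nat.sqrt n) + 4 * m + n) := by
  classical
  set s := Nat.sqrt n with hs
  have hs1 : 1 ≤ s := Nat.le_sqrt.2 (by omega)
  have hnT : n < (s + 1) * (s + 1) := Nat.lt_succ_sqrt n
  have hN'aff : IsAffine N' := by rw [hN'def]; exact isAffine_conj N hN G G'
  -- threshold and coarsening
  set T : ℕ := s + 1 with hTdef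
  have hT : 0 < T := Nat.succ_pos s
  set lvl' : Fin m → ℕ := fun i => coarsen lvl T (lvl i) with hlvl'
  have hcut' : LevelCut N' lvl' := levelCut_mono hcut (coarsen lvl T) (coarsen_mono lvl hT)
  set P' : ℕ := 2 * (m / T) + 2 with hP'def
  have hP' : ∀ i, lvl' i < P' := fun i => coarsen_lt lvl T (lvl i)
  -- certificates on the big levels, transported to class ledgers of N'
  have hbig' : ∀ t : ℕ, ∃ (K : Submodule ℂ (Fin n × Fin n → ℂ)) (k : ℕ), t < L → T ≤ lvlSize lvl t →
      Ledger n m N' (fun i => lvl i = t) K k ∧ n * k + (n * n - Module.finrank ℂ K) ≤ c * (s * lvlSize lvl t) := by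
    intro t
    by_cases ht : t < L ∧ T ≤ lvlSize lvl t
    · obtain ⟨htL, htb⟩ := ht
      obtain ⟨e, K, k, hK, hprice⟩ := hbig t htL htb
      exact ⟨K, k, fun _ _ => ⟨ledger_class_of_classPencil N' hcut e hK, hprice⟩⟩
    · exact ⟨⊤, 0, fun h1 h2 => absurd ⟨h1, h2⟩ ht⟩
  choose Kt kt hKt using hbig'
  -- the freezing set: pairs of small-level coordinates in one merged class
  let Rrel : Fin m → Fin m → Prop := fun i j => lvlSize lvl (lvl i) < T ∧ lvlSize lvl (lvl j) < T ∧ lvl' i = lvl' j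
  set R : Finset (Fin m × Fin m) := Finset.univ.filter fun ij => Rrel ij.1 ij.2 with hRdef
  have hRcard : R.card ≤ m * (2 * T) := by
    refine card_filter_prod_le Rrel fun i => ?_
    by_cases hi : lvlSize lvl (lvl i) < T
    · refine le_of_lt (lt_of_le_of_lt (Finset.card_le_card fun j hj => ?_) (card_small_class_lt lvl hT (lvl' i)))
      simp only [Finset.mem_filter, Finset.mem_univ, true_and, Rrel] at hj ⊢
      exact ⟨hj.2.1, hj.2.2.symm⟩
    · have h0 : (Finset.univ.filter fun j => Rrel i j) = ∅ :=
        Finset.filter_false_of_mem fun j _ h => hi h.1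
      rw [h0, Finset.card_empty]; exact Nat.zero_le _
  set bigS : Finset ℕ := (Finset.range L).filter fun t => T ≤ lvlSize lvl t with hbigS
  set K : Submodule ℂ (Fin n × Fin n → ℂ) := freezeSpace N' R ⊓ bigS.inf Kt with hKdef
  set kb : ℕ → ℕ := fun q => ∑ t ∈ bigS.filter (fun t => coarsen lvl T t = q), kt t with hkbdef
  -- the class ledgers of the merged classes
  have hclass : ∀ q, q < P' → Ledger n m N' (fun i => lvl' i = q) K (kb q) := by
    intro q _
    by_cases hq : ∃ t ∈ bigS, coarsen lvl T t = q
    · obtain ⟨t, htS, htq⟩ := hq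
      have htL : t < L := Finset.mem_range.1 (Finset.mem_filter.1 htS).1
      have htb : T ≤ lvlSize lvl t := (Finset.mem_filter.1 htS).2
      refine ledger_mono (hKt t htL htb).1 (fun i hi => ?_) (inf_le_right.trans (Finset.inf_le htS)) ?_
      · exact eq_of_coarsen_eq_of_big lvl hT htb (by rw [htq]; exact hi)
      · exact Finset.single_le_sum (f := kt) (fun _ _ => Nat.zero_le _) (Finset.mem_filter.2 ⟨htS, htq⟩)
    · push Not at hq
      have hsm : ∀ i, lvl' i = q → lvlSize lvl (lvl i) < T := fun i hi => by
        by_contra hb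
        exact hq (lvl i) (Finset.mem_filter.2 ⟨Finset.mem_range.2 (hlvl i), not_lt.1 hb⟩) hi
      have hfr : Freezes N' (fun i j => lvl' i = q ∧ lvl' j = q) K := by
        intro i j hij v hv
        have hmem : (i, j) ∈ R :=
          Finset.mem_filter.2 ⟨Finset.mem_univ _, hsm i hij.1, hsm j hij.2, hij.1.trans hij.2.symm⟩
        exact linEntry_eq_zero_of_mem_freezeSpace N' R hmem (inf_le_left (b := bigS.inf Kt) hv)
      exact ledger_mono (ledger_class_of_frozen N' hN'aff hcut' q hfr) (fun _ h => h) le_rfl (Nat.zero_le _)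
  -- (b₀): stack the classes; (g3): back to N
  have htop : Ledger n m N' (fun _ => True) K ((∑ q ∈ Finset.range P', kb q) + (P' - 1)) :=
    shortMassLedger0_holds n m P' N' hN'aff lvl' hP' hcut' K kb hclass
  have htopN := ledger_top_of_conj N N' G G' hGG hN'def htop
  refine ⟨K, (∑ q ∈ Finset.range P', kb q) + (P' - 1), htopN, ?_⟩
  -- BUDGET
  have hsumk : ∑ q ∈ Finset.range P', kb q = ∑ t ∈ bigS, kt t :=
    Finset.sum_fiberwise_of_maps_to (fun t _ => Finset.mem_range.2 (coarsen_lt lvl T t)) kt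
  have hprice : n * (∑ t ∈ bigS, kt t) + ∑ t ∈ bigS, (n * n - Module.finrank ℂ (Kt t)) ≤ c * (s * m) := by
    have h1 : ∀ t ∈ bigS, n * kt t + (n * n - Module.finrank ℂ (Kt t)) ≤ c * (s * lvlSize lvl t) := fun t ht =>
      (hKt t (Finset.mem_range.1 (Finset.mem_filter.1 ht).1) (Finset.mem_filter.1 ht).2).2
    calc n * (∑ t ∈ bigS, kt t) + ∑ t ∈ bigS, (n * n - Module.finrank ℂ (Kt t))
        = ∑ t ∈ bigS, (n * kt t + (n * n - Module.finrank ℂ (Kt t))) := by rw [Finset.mul_sum, ← Finset.sum_add_distrib]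
      _ ≤ ∑ t ∈ bigS, c * (s * lvlSize lvl t) := Finset.sum_le_sum h1
      _ = c * (s * ∑ t ∈ bigS, lvlSize lvl t) := by rw [Finset.mul_sum, Finset.mul_sum]
      _ ≤ c * (s * ∑ t ∈ Finset.range L, lvlSize lvl t) :=
        Nat.mul_le_mul_left _ (Nat.mul_le_mul_left _ (Finset.sum_le_sum_of_subset (Finset.filter_subset _ _)))
      _ = c * (s * m) := by rw [sum_lvlSize_eq lvl hlvl]
  have hcodim : n * n - Module.finrank ℂ K ≤ R.card + ∑ t ∈ bigS, (n * n - Module.finrank ℂ (Kt t)) :=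
    (codim_inf_le _ _).trans (add_le_add (codim_freezeSpace_le N' R) (codim_finset_inf_le bigS Kt))
  have hKle := finrank_dir_le n K
  have hPn : (m / T) * n ≤ m * T :=
    calc (m / T) * n ≤ (m / T) * (T * T) := Nat.mul_le_mul_left _ hnT.le
      _ = (m / T * T) * T := by ring
      _ ≤ m * T := Nat.mul_le_mul_right _ (Nat.div_mul_le_self m T)
  have hexp : n * (∑ t ∈ bigS, kt t + (P' - 1)) = n * ∑ t ∈ bigS, kt t + 2 * ((m / T) * n) + n := by
    have h1 : P' - 1 = 2 * (m / T) + 1 := by omega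
    rw [h1]; ring
  rw [hsumk, hexp]
  have hmT : m * T = m * s + m := by rw [hTdef]; ring
  have hR2 : m * (2 * T) = 2 * (m * s) + 2 * m := by rw [hTdef]; ring
  have hcsm : c * (s * m) = c * (Nat.sqrt n * m) := by rw [hs]
  have hms : m * Nat.sqrt n = m * s := by rw [hs]
  omega

/-- ★ **IRREDUCIBILITY IS FREE, pointwise in `n`.**  If at some `n ≥ 1` every `IrreducibleInv` nilpotent affine pencil of every size `b` has price
`≤ c·√n·b`, then EVERY nilpotent affine `m × m` pencil has price `≤ (c + 10)·√n·m` (composition series in matrix clothes ✓ `exists_block_conj`,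
nilpotency and irreducibility descend to the class pencils, `relCert_of_levelCut`; `m ≤ √n`: `relCert_freeze_all`). -/
theorem relCert_of_inv_at (hn : 1 ≤ n) {c : ℕ}
    (hcn : ∀ b : ℕ, ∀ Q : AffMat n b, IsAffine Q → Q ^ b = 0 → IrreducibleInv Q → RelCert n b Q (c * (Nat.sqrt n * b)))
    (N : AffMat n m) (hN : IsAffine N) (hnil : N ^ m = 0) : RelCert n m N ((c + 10) * (Nat.sqrt n * m)) := by
  classical
  set s := Nat.sqrt n with hs
  have hs1 : 1 ≤ s := Nat.le_sqrt.2 (by omega)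
  have hnT : n < (s + 1) * (s + 1) := Nat.lt_succ_sqrt n
  by_cases hsmall : m ≤ s
  · -- SMALL m: freeze everything, m² ≤ √n·m
    obtain ⟨K, k, hK, hcost⟩ := relCert_freeze_all N hN
    refine ⟨K, k, hK, hcost.trans ?_⟩
    calc m * m ≤ s * m := Nat.mul_le_mul_right _ hsmall
      _ ≤ (c + 10) * (s * m) := Nat.le_mul_of_pos_left _ (by omega)
  · -- LARGE m (√n + 1 ≤ m): composition series, (c) on the big classes, sub-additivity
    push Not at hsmall
    obtain ⟨P, L, lvl, hlvl, _hLm, _hne, hblock, hirr⟩ :=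
      exists_block_conj (Set.range fun x : Fin n × Fin n → ℂ => N.map (MvPolynomial.eval x))
    set G : Matrix (Fin m) (Fin m) ℂ := (P : Matrix (Fin m) (Fin m) ℂ) with hG
    set G' : Matrix (Fin m) (Fin m) ℂ := (↑P⁻¹ : Matrix (Fin m) (Fin m) ℂ) with hG'
    have hGG : G' * G = 1 := Units.inv_mul P
    have hGG' : G * G' = 1 := Units.mul_inv P
    set N' : AffMat n m := G.map C * N * G'.map C with hN'def
    have hN'aff : IsAffine N' := isAffine_conj N hN G G'
    have hN'nil : N' ^ m = 0 := conj_pow_eq_zero N G G' hGG hGG' hnil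
    have hcut : LevelCut N' lvl :=
      levelCut_of_values N' lvl fun x i j hij => by rw [hN'def, conj_map_eval]; exact hblock _ ⟨x, rfl⟩ i j hij
    have hbig : ∀ t : ℕ, t < L → Nat.sqrt n + 1 ≤ lvlSize lvl t →
        ∃ (e : {i : Fin m // lvl i = t} ≃ Fin (lvlSize lvl t)),
          RelCert n (lvlSize lvl t) (classPencil N' e) (c * (Nat.sqrt n * lvlSize lvl t)) := by
      intro t htL _
      have hcardt : Fintype.card {i : Fin m // lvl i = t} = lvlSize lvl t := by rw [Fintype.card_subtype]; rfl
      let e : {i : Fin m // lvl i = t} ≃ Fin (lvlSize lvl t) := Fintype.equivFinOfCardEq hcardt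
      exact ⟨e, hcn (lvlSize lvl t) (classPencil N' e) (isAffine_classPencil N' hN'aff e)
        (pow_card_eq_zero_of_pow_eq_zero _ (classPencil_pow_eq_zero N' hcut e hN'nil))
        (irreducibleInv_classPencil N G G' e (hirr t htL _ e))⟩
    obtain ⟨K, k, hK, hcost⟩ := relCert_of_levelCut hn c N N' hN G G' hGG rfl lvl hlvl hcut hbig
    rw [← hs] at hcost
    refine ⟨K, k, hK, hcost.trans ?_⟩
    -- (c·s·m + 4·m·s + 4·m + n ≤ (c+10)·s·m) from s + 1 ≤ m, 1 ≤ s, n < (s+1)²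
    have h0 : (s + 1) * (s + 1) ≤ 2 * (s * m) := by nlinarith
    have h1 : n ≤ 2 * (s * m) := hnT.le.trans h0
    have h2 : 4 * m ≤ 4 * (s * m) := by nlinarith
    have h3 : (c + 10) * (s * m) = c * (s * m) + 10 * (s * m) := by ring
    have h4 : m * s = s * m := Nat.mul_comm m s
    rw [h3, h4]
    omega

end SubAdditivity

/-- ★ **`LongMassSlowLawInv → LongMassSlowLawAll`** (`c ↦ c + 10`, `n₀ ↦ max n₀ 1`). -/
theorem all_of_inv (h : LongMassSlowLawInv) : LongMassSlowLawAll := by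
  obtain ⟨c, n₀, hc⟩ := h
  refine ⟨c + 10, max n₀ 1, fun n hn b B hB hnil => ?_⟩
  have hn₀ : n₀ ≤ n := le_trans (le_max_left _ _) hn
  have hn1 : 1 ≤ n := le_trans (le_max_right _ _) hn
  exact relCert_of_inv_at hn1 (fun b' Q hQ hQnil hQirr => hc n hn₀ b' Q hQ hQnil hQirr) B hB hnil

/-- ★★ **IRREDUCIBILITY IS FREE**: the stub's research statement (c) `LongMassSlowLawInv` is EQUIVALENT to (c) for all nilpotent affine pencils. -/
theorem inv_iff_all : LongMassSlowLawInv ↔ LongMassSlowLawAll := ⟨all_of_inv, inv_of_all⟩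

/-- Corollary for refuters (contrapositive, by name): a family of nilpotent AFFINE pencils — reducible, graded, torus-fixed or not — whose price
is not `O(√n·b)` refutes the stub's (c).  No «limit of irreducibles» clause is needed. -/
theorem not_inv_of_not_all (h : ¬ LongMassSlowLawAll) : ¬ LongMassSlowLawInv := fun hi => h (all_of_inv hi)

/-! ## Axiom guard (standard axioms only) -/

/-- info: 'Summit.ValiantsHypothesis.ValiantsHypothesis.Cruxes.DualUnipotentThreeHalves.IrreducibilityIsFree.relCert_of_levelCut' depends on axioms: [propext, Classical.choice, Quot.sound] -/
#guard_msgs (whitespace := lax) in #print axioms relCert_of_levelCut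

/-- info: 'Summit.ValiantsHypothesis.ValiantsHypothesis.Cruxes.DualUnipotentThreeHalves.IrreducibilityIsFree.inv_iff_all' depends on axioms: [propext, Classical.choice, Quot.sound] -/
#guard_msgs (whitespace := lax) in #print axioms inv_iff_all

end Summit.ValiantsHypothesis.ValiantsHypothesis.Cruxes.DualUnipotentThreeHalves.IrreducibilityIsFree
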